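import Mathlib
import Literature.Probability.LatticeModels.LatticeGraph
import Summits.CriticalPhenomena.Ising3DConformalLimit.Theorems.GaussianScaleMixtureCriticalTwoPointGSMCubeRepOfApproximants

/-!
# Cube representations from approximate finite cube representations (compactness step)

Pure measure theory (Prokhorov on a compact set + portmanteau), used by line `Sketch` of the crux
`CriticalTwoPointGSM` (stmt-CriticalPhenomena-8365), in the step "closed Gaussian-scale-mixture
cone = dual cone".

A CUBE REPRESENTATION of a kernel `G : ℤ³ → ℝ` is a probability measure `μ` on `ℝ³` carried by the
closed cube `[0,1]³` (no mass on the open complement `{t | ∃ i, tᵢ < 0 ∨ 1 < tᵢ}`) with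
`G x = ∫ ∏ᵢ tᵢ^{xᵢ²} dμ(t)` for every site `x` (natural-number powers, `0⁰ = 1`). The main theorem
`cubeRep_of_cubeRepApprox` is the compactness step: if for every finite family of sites and every
`ε > 0` some cube probability measure matches `G` on the family up to `ε`, then `G` has an exact
cube representation on all of `ℤ³`.

Proof: enumerate `ℤ³ = {e 0, e 1, …}`; let `μ_N` match `G` on `e 0, …, e N` up to `1/(N+1)`. All
`μ_N` live on the compact cube, so the family is tight for free
(`CriticalTwoPointGSMCubeLimit.isTightMeasureSet_of_cubeNull`); Prokhorov's theorem
(`MeasureTheory.isCompact_closure_of_isTightMeasureSet`) and metrisability of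
`ProbabilityMeasure (Fin 3 → ℝ)` give a weakly convergent subsequence `μ_{φ N} → μ`; the limit is
carried by the cube by the portmanteau inequality for the open complement
(`CriticalTwoPointGSMCubeLimit.cubeNull_of_tendsto`); and for each fixed site `x = e j` the
integrals `∫ ∏ tᵢ^{xᵢ²} dμ_{φ N}` converge to `∫ ∏ tᵢ^{xᵢ²} dμ` because on the cube the polynomial
kernel agrees with the bounded continuous clamped kernel `∏ (max 0 (min tᵢ 1))^{xᵢ²}`
(`CriticalTwoPointGSMCubeLimit.tendsto_integral_kernel`), while they are within `1/(φ N + 1)` of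
`G x` as soon as `φ N ≥ j`. The cube helpers `CriticalTwoPointGSMCube.*` of the sibling file
`…CubeRepOfApproximants` are reused.
-/

namespace Summit.CriticalPhenomena.Ising3DConformalLimit.Theorems

open MeasureTheory Filter Topology
open Literature.Probability.LatticeModels
open scoped BigOperators

namespace CriticalTwoPointGSMCubeLimit

open CriticalTwoPointGSMCube

/-- A set of measures on `ℝ³` each giving no mass to the complement of the closed cube `[0,1]³`
is tight: the cube is compact. -/
theorem isTightMeasureSet_of_cubeNull {S : Set (Measure (Fin 3 → ℝ))}
    (h : ∀ ρ ∈ S, ρ {t | ∃ i, t i < 0 ∨ 1 < t i} = 0) : IsTightMeasureSet S := by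
  rw [isTightMeasureSet_iff_exists_isCompact_measure_compl_le]
  intro ε _
  refine ⟨Set.pi Set.univ fun _ => Set.Icc (0 : ℝ) 1, isCompact_univ_pi fun _ => isCompact_Icc,
    fun ρ hρ => ?_⟩
  have hsub : (Set.pi Set.univ fun _ : Fin 3 => Set.Icc (0 : ℝ) 1)ᶜ ⊆
      {t | ∃ i, t i < 0 ∨ 1 < t i} := by
    intro t ht
    simpa only [Set.mem_compl_iff, Set.mem_univ_pi, Set.mem_Icc, not_forall, not_and_or,
      not_le, Set.mem_setOf_eq] using ht
  rw [measure_mono_null hsub (h ρ hρ)]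
  exact bot_le

/-- A weak limit of probability measures carried by the closed cube `[0,1]³` is carried by the
closed cube (portmanteau inequality `μ U ≤ liminf μₙ U` for the open complement `U`). -/
theorem cubeNull_of_tendsto {P : ℕ → ProbabilityMeasure (Fin 3 → ℝ)}
    {μ : ProbabilityMeasure (Fin 3 → ℝ)} (hlim : Tendsto P atTop (𝓝 μ))
    (h : ∀ n, (P n : Measure (Fin 3 → ℝ)) {t | ∃ i, t i < 0 ∨ 1 < t i} = 0) :
    (μ : Measure (Fin 3 → ℝ)) {t | ∃ i, t i < 0 ∨ 1 < t i} = 0 := by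
  have hle := ProbabilityMeasure.le_liminf_measure_open_of_tendsto hlim isOpen_offCube
  have h0 : (fun n => (P n : Measure (Fin 3 → ℝ)) {t | ∃ i, t i < 0 ∨ 1 < t i}) = fun _ => 0 :=
    funext h
  rw [h0, liminf_const] at hle
  exact le_antisymm hle bot_le

/-- Along a weakly convergent sequence of probability measures carried by the closed cube, the
integrals of the polynomial kernel `t ↦ ∏ᵢ tᵢ^{|xᵢ|²}` converge to the integral against the limit:
weak convergence is tested on the bounded continuous clamped kernel
`∏ᵢ (max 0 (min tᵢ 1))^{|xᵢ|²}`, which has the same integrals since all the measures (including the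
limit) live on the cube. -/
theorem tendsto_integral_kernel {P : ℕ → ProbabilityMeasure (Fin 3 → ℝ)}
    {μ : ProbabilityMeasure (Fin 3 → ℝ)} (hlim : Tendsto P atTop (𝓝 μ))
    (h : ∀ n, (P n : Measure (Fin 3 → ℝ)) {t | ∃ i, t i < 0 ∨ 1 < t i} = 0) (x : Site 3) :
    Tendsto (fun n => ∫ t, ∏ i, (t i) ^ ((x i).natAbs ^ 2) ∂(P n : Measure (Fin 3 → ℝ)))
      atTop (𝓝 (∫ t, ∏ i, (t i) ^ ((x i).natAbs ^ 2) ∂(μ : Measure (Fin 3 → ℝ)))) := by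
  let f : BoundedContinuousFunction (Fin 3 → ℝ) ℝ :=
    BoundedContinuousFunction.ofNormedAddCommGroup
      (fun t : Fin 3 → ℝ => ∏ i, (max 0 (min (t i) 1)) ^ ((x i).natAbs ^ 2))
      (continuous_clampKernel x) 1 (norm_clampKernel_le_one x)
  have hf := (ProbabilityMeasure.tendsto_iff_forall_integral_tendsto.1 hlim) f
  have h1 : (fun n => ∫ t, f t ∂(P n : Measure (Fin 3 → ℝ))) =
      fun n => ∫ t, ∏ i, (t i) ^ ((x i).natAbs ^ 2) ∂(P n : Measure (Fin 3 → ℝ)) :=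
    funext fun n => integral_clampKernel_eq (h n) x
  have h2 : ∫ t, f t ∂(μ : Measure (Fin 3 → ℝ)) =
      ∫ t, ∏ i, (t i) ^ ((x i).natAbs ^ 2) ∂(μ : Measure (Fin 3 → ℝ)) :=
    integral_clampKernel_eq (cubeNull_of_tendsto hlim h) x
  rw [h1, h2] at hf
  exact hf

/-- Elementary limit lemma: if `|a - u n| < 1 / (φ n + 1)` whenever `j ≤ φ n`, for a strictly
increasing `φ : ℕ → ℕ` and a fixed threshold `j`, then `u n → a`. -/
theorem tendsto_of_abs_sub_lt {a : ℝ} {u : ℕ → ℝ} {φ : ℕ → ℕ} (hφ : StrictMono φ) (j : ℕ)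
    (h : ∀ n, j ≤ φ n → |a - u n| < 1 / ((φ n : ℝ) + 1)) : Tendsto u atTop (𝓝 a) := by
  rw [Metric.tendsto_atTop]
  intro ε hε
  have hsmall : Tendsto (fun n => 1 / ((φ n : ℝ) + 1)) atTop (𝓝 0) :=
    (tendsto_one_div_add_atTop_nhds_zero_nat (𝕜 := ℝ)).comp hφ.tendsto_atTop
  obtain ⟨N₀, hN₀⟩ := Metric.tendsto_atTop.1 hsmall ε hε
  refine ⟨max N₀ j, fun n hn => ?_⟩
  have hb := hN₀ n (le_of_max_le_left hn)
  rw [Real.dist_eq, sub_zero, abs_of_pos (by positivity)] at hb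
  rw [Real.dist_eq, abs_sub_comm]
  exact (h n ((le_of_max_le_right hn).trans (hφ.id_le n))).trans hb

end CriticalTwoPointGSMCubeLimit

open CriticalTwoPointGSMCubeLimit in
/-- **Compactness step: approximate finite cube representations give an exact cube
representation.** If for every finite family of sites `x : Fin m → ℤ³` and every `ε > 0` there is
a probability measure on `ℝ³` carried by the closed cube `[0,1]³` whose polynomial-kernel
integrals `∫ ∏ᵢ tᵢ^{(x k)ᵢ²} dμ` match `G (x k)` up to `ε` for all `k`, then `G` has a cube
representation: a probability measure `μ` carried by `[0,1]³` with `G x = ∫ ∏ᵢ tᵢ^{xᵢ²} dμ` for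
every `x ∈ ℤ³`. Enumerate `ℤ³`, take the `1/(N+1)`-approximant on the first `N+1` sites,
extract a weakly convergent subsequence by Prokhorov (tightness is free on the compact cube),
and identify the limit site by site via the bounded continuous clamped kernels. -/
theorem cubeRep_of_cubeRepApprox (G : Site 3 → ℝ)
    (happrox : ∀ (m : ℕ) (x : Fin m → Site 3) (ε : ℝ), 0 < ε →
      ∃ μ : Measure (Fin 3 → ℝ), IsProbabilityMeasure μ ∧ μ {t | ∃ i, t i < 0 ∨ 1 < t i} = 0 ∧
        ∀ k, |G (x k) - ∫ t, ∏ i, (t i) ^ ((x k i).natAbs ^ 2) ∂μ| < ε) :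
    ∃ μ : Measure (Fin 3 → ℝ), IsProbabilityMeasure μ ∧ μ {t | ∃ i, t i < 0 ∨ 1 < t i} = 0 ∧
      ∀ x : Site 3, G x = ∫ t, ∏ i, (t i) ^ ((x i).natAbs ^ 2) ∂μ := by
  -- Step 1: enumerate the (countably many) sites of `ℤ³`.
  obtain ⟨e, he⟩ := exists_surjective_nat (Site 3)
  -- Step 2: the `N`-th approximant matches `G` on `e 0, …, e N` up to `1/(N+1)`.
  have hN : ∀ N : ℕ, ∃ μ : Measure (Fin 3 → ℝ), IsProbabilityMeasure μ ∧
      μ {t | ∃ i, t i < 0 ∨ 1 < t i} = 0 ∧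
      ∀ k : Fin (N + 1), |G (e k) - ∫ t, ∏ i, (t i) ^ ((e k i).natAbs ^ 2) ∂μ| <
        1 / ((N : ℝ) + 1) :=
    fun N => happrox (N + 1) (fun k => e k) (1 / ((N : ℝ) + 1)) (by positivity)
  choose ρ hρP hρcube hρapprox using hN
  -- Step 3: Prokhorov on the compact cube gives a weakly convergent subsequence.
  let P : ℕ → ProbabilityMeasure (Fin 3 → ℝ) := fun n => ⟨ρ n, hρP n⟩
  have htight : IsTightMeasureSet
      {((Q : ProbabilityMeasure (Fin 3 → ℝ)) : Measure (Fin 3 → ℝ)) | Q ∈ Set.range P} := by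
    refine isTightMeasureSet_of_cubeNull ?_
    rintro _ ⟨Q, ⟨n, rfl⟩, rfl⟩
    exact hρcube n
  obtain ⟨μ, -, φ, hφ, hμ⟩ := (isCompact_closure_of_isTightMeasureSet htight).tendsto_subseq
    (x := P) fun n => subset_closure (Set.mem_range_self n)
  have hPcube : ∀ n, ((P ∘ φ) n : Measure (Fin 3 → ℝ)) {t | ∃ i, t i < 0 ∨ 1 < t i} = 0 :=
    fun n => hρcube (φ n)
  -- Step 4: the limit is carried by the cube and represents `G` at every site `x = e j`.
  refine ⟨μ, inferInstance, cubeNull_of_tendsto hμ hPcube, fun x => ?_⟩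
  obtain ⟨j, rfl⟩ := he x
  have hlimG : Tendsto
      (fun n => ∫ t, ∏ i, (t i) ^ ((e j i).natAbs ^ 2) ∂((P ∘ φ) n : Measure (Fin 3 → ℝ)))
      atTop (𝓝 (G (e j))) :=
    tendsto_of_abs_sub_lt hφ j fun n hn => hρapprox (φ n) ⟨j, Nat.lt_succ_of_le hn⟩
  exact tendsto_nhds_unique hlimG (tendsto_integral_kernel hμ hPcube (e j))

end Summit.CriticalPhenomena.Ising3DConformalLimit.Theorems
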